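import Literature.NumberTheory.EllipticCurves.HidaOrdinaryCohomologyLattice
import Literature.NumberTheory.ModularForms.ParabolicConjugacy
import Literature.NumberTheory.ModularForms.ParabolicCohomologyGamma0Field
import Mathlib.Data.ZMod.QuotientGroup
import HarnessLib

/-!
# `U_p` maps homomorphisms of `Γ₀(N)` vanishing on the parabolic elements above `∞`
# to homomorphisms vanishing on all parabolic elements, modulo `p`

Fourth file of the cohomological proof of the deep half of Hida's rank constancy (serving the
named fact `Literature.NumberTheory.EllipticCurves.hida_exists_congruent_ordinary_newform`; see
`HidaOrdinaryCohomologySymPow`, `HidaOrdinaryCohomologyCocycles`, `HidaOrdinaryCohomologyLattice`).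

Let `p ∣ N` and let `R` be a ring with `p = 0`.  A parabolic element `Q` of `Γ₀(N)` is
`± g T^w g⁻¹` (`ParabolicConj.exists_conj_T_zpow_of_isParabolic`); it has the integral eigenvector
`g e₀ = (a, c)` for the eigenvalue `±1` (`IsEigenElt`), and its cusp `a/c` lies above the cusp `∞`
of `X₀(p)` iff `p ∣ c`.  For additive maps `u : Γ₀(N) → R` consider

* `parSp N R`  — `u` vanishes on every parabolic element (the parabolic cocycles of weight `2`,
  Shimura (8.1.4) with `n = 0`; over a field `K` this is the tree's `ParabolicCountK.parabolicHoms`,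
  `toHom_mem_parabolicHoms`), and
* `infSp N p R` — `u` vanishes on the parabolic elements whose eigenvector `(a, c)` has `p ∣ c`,
  `p ∤ a` (cusps above `∞`).

**Main result** (`heckeU_apply_eq_zero_of_mem_infSp`, `heckeU_mem_parSp_of_mem_infSp`): for
`u ∈ infSp`, `U_p u ∈ parSp`.  Proof: `(U_p u)(π) = ∑ᵢ u(γ'ᵢ)` with `βᵢ π = γ'ᵢ β_{σ(i)}`
(`HidaOrdinaryCohomologyCocycles.heckeU`); summing along the orbits of the permutation `σ`
(`sum_eq_sum_orbits`) the partial products telescope to `Q = βᵢ π^m βᵢ⁻¹ ∈ Γ₀(N)`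
(`gmat_cyc_mul`), a conjugate of `± T^{wm}` by the integer matrix `βᵢ g` of determinant `p`, with
first column `(a + i c, p c)`.  If `p ∤ a + ic` then `Q` is parabolic above `∞` and `u(Q) = 0`.
If `p ∣ a + ic` then `βᵢ g = g' diag(p, 1)` with `g' ∈ SL₂(ℤ)` of the same lower-left entry `c`,
so `Q = ± g' T^{pwm} g'⁻¹ = z^p` with `z = ± g' T^{wm} g'⁻¹ ∈ Γ₀(N)` (its lower-left entry is
`-wm c² ≡ 0 mod N` because that of `π` is `∓ w c²`), and `u(Q) = p · u(z) = 0`.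
This is the group-theoretic shadow of the fact that `U_p` acts on the constant terms at the
cusps above `0` of `X₀(p)` through multiplication by `p` (the coset representatives raise the
level at those cusps), i.e. of Hida's observation that the ordinary projector kills the boundary
at the cusps above `0` [Hida 1986 ENS, §4; Hida, *Elementary Modular Iwasawa Theory*, §4.2.10].

Consequences for the **non-nilpotent ranks** `ρ(T | V) := dim V - dim V₀(T)` (over a field of
characteristic `p`): `ρ(U_p | infSp) ≤ ρ(U_p | parSp)` (`finrank_sub_le_parSp`), and for a
`U_p`-stable subspace `V ⊆ (Γ₀(N) → Symⁿ(K²))` whose `uⁿ`-coefficients lie in `infSp`,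
`ρ(U_p | V) ≤ ρ(U_p | parSp)` (`finrank_sub_le_parSp_of_proj0`, Hida's contraction
`HidaOrdinaryCohomologyCocycles.finrank_sub_finrank_maxGenEigenspace_zero_le`).  Finally
`dim parSp ≤ 2 dim S₂(Γ₀(N))` when `2, 3 ≠ 0` in `K` (`finrank_parSp_le`, the tree's Mazur count
`ParabolicCountK.finrank_parabolicHoms_le`).  Everything is proved; no named facts.

## References

* G. Shimura, *Introduction to the arithmetic theory of automorphic functions* (1971), §1.3–1.5
  (parabolic elements), §8.1 ((8.1.4)), §8.3 ((8.3.2)). [Shimura1971]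
* H. Hida, *Iwasawa modules attached to congruences of cusp forms*, Ann. Sci. ENS 19 (1986), §4
  (Prop. 4.7). [Hida1986ENS]
* H. Hida, *Elementary Modular Iwasawa Theory*, World Scientific 2022, §4.2.10–§4.2.11.
  [Hida2022EMI]
* B. Mazur, *Modular curves and the Eisenstein ideal*, Publ. Math. IHÉS 47 (1977), II.5–II.9.
  [Mazur1977]
-/

noncomputable section

open scoped MatrixGroups
open CongruenceSubgroup Matrix Module Module.End MulAction Function
open Literature.NumberTheory.ModularForms (ParabolicConj.exists_conj_T_zpow_of_isParabolic
  ParabolicCountK.parabolicHoms ParabolicCountK.finrank_parabolicHoms_le ParabolicCountK.liftHom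
  ParabolicCountK.liftHom_injective)

namespace Literature.NumberTheory.EllipticCurves.ModularForms.HidaCohomology

/-! ### Sums along the orbits of a permutation -/

section OrbitSum

variable {ι : Type*} [Fintype ι] {M : Type*} [AddCommMonoid M]

/-- The points of the `⟨σ⟩`-orbit of `b` are the `σ^t b`, `t <` the minimal period. [folklore] -/
theorem exists_lt_minimalPeriod_of_mem_orbit (σ : Equiv.Perm ι) {b i : ι}
    (h : i ∈ orbit (Subgroup.zpowers σ) b) :
    ∃ t < minimalPeriod σ b, (σ ^ t) b = i := by
  obtain ⟨⟨g, hg⟩, rfl⟩ := h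
  obtain ⟨k, rfl⟩ := Subgroup.mem_zpowers_iff.mp hg
  have hm : 0 < minimalPeriod σ b := Nat.pos_of_ne_zero (NeZero.ne (minimalPeriod (σ • ·) b))
  have h0 : 0 ≤ k % (minimalPeriod σ b : ℤ) := Int.emod_nonneg _ (by exact_mod_cast hm.ne')
  refine ⟨(k % (minimalPeriod σ b : ℤ)).toNat, ?_, ?_⟩
  · have h1 : (k % (minimalPeriod σ b : ℤ)) < (minimalPeriod σ b : ℤ) :=
      Int.emod_lt_of_pos _ (by exact_mod_cast hm)
    omega
  · have key := zpow_smul_mod_minimalPeriod σ b k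
    change (σ ^ (k % (minimalPeriod σ b : ℤ))) b = (σ ^ k) b at key
    change (σ ^ (k % (minimalPeriod σ b : ℤ)).toNat) b = (σ ^ k) b
    rw [← key, ← zpow_natCast, Int.toNat_of_nonneg h0]

omit [Fintype ι] in
/-- `t ↦ σ^t b` is injective below the minimal period. [folklore] -/
theorem pow_apply_injOn_lt_minimalPeriod (σ : Equiv.Perm ι) (b : ι) {s t : ℕ}
    (hs : s < minimalPeriod σ b) (ht : t < minimalPeriod σ b) (h : (σ ^ s) b = (σ ^ t) b) :
    s = t := by
  have h' : σ^[s] b = σ^[t] b := by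
    rwa [← Equiv.Perm.coe_pow, ← Equiv.Perm.coe_pow]
  exact (iterate_eq_iterate_iff_of_lt_minimalPeriod hs ht).mp h'

/-- **Orbit decomposition of a sum along a permutation**:
`∑ᵢ F i = ∑_{orbits q} ∑_{t < m_q} F (σ^t q.out)`. [folklore] -/
theorem sum_eq_sum_orbits (σ : Equiv.Perm ι) (F : ι → M)
    [Fintype (orbitRel.Quotient (Subgroup.zpowers σ) ι)] :
    ∑ i, F i = ∑ q : orbitRel.Quotient (Subgroup.zpowers σ) ι,
      ∑ t ∈ Finset.range (minimalPeriod σ q.out), F ((σ ^ t) q.out) := by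
  classical
  have hfib : ∑ i, F i = ∑ q : orbitRel.Quotient (Subgroup.zpowers σ) ι,
      ∑ i ∈ Finset.univ.filter
        (fun i ↦ (Quotient.mk'' i : orbitRel.Quotient (Subgroup.zpowers σ) ι) = q), F i := by
    rw [← Finset.sum_fiberwise_of_maps_to
      (g := fun i ↦ (Quotient.mk'' i : orbitRel.Quotient (Subgroup.zpowers σ) ι))
      (t := Finset.univ) (fun _ _ ↦ Finset.mem_univ _)]
  rw [hfib]
  refine Finset.sum_congr rfl fun q _ ↦ ?_
  have himg : Finset.univ.filter
      (fun i ↦ (Quotient.mk'' i : orbitRel.Quotient (Subgroup.zpowers σ) ι) = q) =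
      (Finset.range (minimalPeriod σ q.out)).image (fun t ↦ (σ ^ t) q.out) := by
    ext i
    simp only [Finset.mem_filter, Finset.mem_univ, true_and, Finset.mem_image, Finset.mem_range]
    constructor
    · intro hi
      have hmem : i ∈ orbit (Subgroup.zpowers σ) q.out := by
        have h' : (Quotient.mk'' i : orbitRel.Quotient (Subgroup.zpowers σ) ι) =
            Quotient.mk'' q.out := by
          rw [hi, Quotient.out_eq']
        exact orbitRel_apply.mp (Quotient.exact' h')
      obtain ⟨t, ht, rfl⟩ := exists_lt_minimalPeriod_of_mem_orbit σ hmem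
      exact ⟨t, ht, rfl⟩
    · rintro ⟨t, -, rfl⟩
      have h' : (Quotient.mk'' ((σ ^ t) q.out) : orbitRel.Quotient (Subgroup.zpowers σ) ι) =
          Quotient.mk'' q.out :=
        Quotient.sound' (orbitRel_apply.mpr ⟨⟨σ ^ t, Subgroup.mem_zpowers_iff.mpr ⟨t, by simp⟩⟩, rfl⟩)
      rw [h', Quotient.out_eq']
  rw [himg, Finset.sum_image]
  intro s hs t ht hst
  exact pow_apply_injOn_lt_minimalPeriod σ q.out (Finset.mem_range.mp hs) (Finset.mem_range.mp ht) hst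

end OrbitSum

/-! ### Products along the orbits of the Hecke permutation -/

section Cyc

variable {N p : ℕ} [NeZero p] (hp : p.Prime)

/-- **Partial products along the `σ_π`-orbit of a Hecke coset**:
`cyc π i t = γ'_i γ'_{σ i} ⋯ γ'_{σ^{t-1} i}`. [folklore] -/
def cyc (π : Gamma0 N) (i : HeckeIdx N p) : ℕ → Gamma0 N
  | 0 => 1
  | t + 1 => cyc π i t * heckePermElt hp π ((heckePermEquiv hp π ^ t) i)

/-- `cyc π i 0 = 1`. [folklore] -/
@[simp] theorem cyc_zero (π : Gamma0 N) (i : HeckeIdx N p) : cyc hp π i 0 = 1 := rfl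

/-- `cyc π i (t+1) = cyc π i t * γ'_{σ^t i}`. [folklore] -/
theorem cyc_succ (π : Gamma0 N) (i : HeckeIdx N p) (t : ℕ) :
    cyc hp π i (t + 1) = cyc hp π i t * heckePermElt hp π ((heckePermEquiv hp π ^ t) i) := rfl

/-- **The telescoping identity** `cyc π i t · β_{σ^t i} = βᵢ · πᵗ`. [cite: Shimura1971, §8.3 p. 237] -/
theorem gmat_cyc_mul (π : Gamma0 N) (i : HeckeIdx N p) (t : ℕ) :
    gmat (cyc hp π i t) * heckeRep p ((heckePermEquiv hp π ^ t) i).1 =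
      heckeRep p i.1 * gmat π ^ t := by
  induction t with
  | zero => simp
  | succ t ih =>
    rw [cyc_succ, gmat_mul, pow_succ' (heckePermEquiv hp π), Equiv.Perm.mul_apply,
      heckePermEquiv_apply, Matrix.mul_assoc, gmat_heckePermElt_mul hp π, ← Matrix.mul_assoc, ih,
      Matrix.mul_assoc, pow_succ]

/-- An additive map sums along the partial products:
`u (cyc π i t) = ∑_{s<t} u(γ'_{σ^s i})`. [folklore] -/
theorem apply_cyc {R : Type*} [AddCommMonoid R] (u : Gamma0 N → R)
    (hadd : ∀ γ δ, u (γ * δ) = u δ + u γ) (h1 : u 1 = 0) (π : Gamma0 N) (i : HeckeIdx N p) (t : ℕ) :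
    u (cyc hp π i t) = ∑ s ∈ Finset.range t, u (heckePermElt hp π ((heckePermEquiv hp π ^ s) i)) := by
  induction t with
  | zero => simp [h1]
  | succ t ih => rw [cyc_succ, hadd, ih, Finset.sum_range_succ, add_comm]

end Cyc

/-! ### Parabolic elements through their integral eigenvectors -/

section Eigen

variable {N : ℕ}

/-- `Q ∈ Γ₀(N)` is a **non-trivial element with integral eigenvector `v` for the eigenvalue `±1`**
(equivalently, a parabolic element fixing the cusp `v₀/v₁`). [cite: Shimura1971, §1.3] -/
def IsEigenElt (Q : Gamma0 N) (v : Fin 2 → ℤ) : Prop :=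
  v ≠ 0 ∧ (gmat Q *ᵥ v = v ∨ gmat Q *ᵥ v = -v) ∧ gmat Q ≠ 1 ∧ gmat Q ≠ -1

/-- The first column of `g ∈ SL₂(ℤ)`. [folklore] -/
def col0 (g : SL(2, ℤ)) : Fin 2 → ℤ := ![g 0 0, g 1 0]

/-- The first column of `g ∈ SL₂(ℤ)` is non-zero. [folklore] -/
theorem col0_ne_zero (g : SL(2, ℤ)) : col0 g ≠ 0 := by
  intro h
  have h0 : g 0 0 = 0 := by simpa [col0] using congrFun h 0
  have h1 : g 1 0 = 0 := by simpa [col0] using congrFun h 1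
  have hdet := Matrix.det_fin_two (g : Matrix (Fin 2) (Fin 2) ℤ)
  rw [g.det_coe, h0, h1] at hdet
  simp at hdet

/-- `g e₀ = col0 g`. [folklore] -/
theorem mulVec_e0 (g : SL(2, ℤ)) : (g : Matrix (Fin 2) (Fin 2) ℤ) *ᵥ ![1, 0] = col0 g := by
  funext k
  fin_cases k <;> simp [col0, Matrix.mulVec, dotProduct, Fin.sum_univ_two]

/-- `T^w e₀ = e₀`. [folklore] -/
theorem T_zpow_mulVec_e0 (w : ℤ) :
    ((ModularGroup.T ^ w : SL(2, ℤ)) : Matrix (Fin 2) (Fin 2) ℤ) *ᵥ ![1, 0] = ![1, 0] := by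
  rw [ModularGroup.coe_T_zpow]
  funext k
  fin_cases k <;> simp [Matrix.mulVec, dotProduct, Fin.sum_univ_two]

/-- Lower-left entry of a conjugate of `T^w`: `(g T^w g⁻¹)₁₀ = -w c²`. [folklore] -/
theorem conj_T_zpow_apply_10 (g : SL(2, ℤ)) (w : ℤ) :
    (g * ModularGroup.T ^ w * g⁻¹ : SL(2, ℤ)) 1 0 = -w * g 1 0 ^ 2 := by
  rw [Matrix.SpecialLinearGroup.coe_mul, Matrix.SpecialLinearGroup.coe_mul,
    Matrix.SpecialLinearGroup.coe_inv, ModularGroup.coe_T_zpow, Matrix.adjugate_fin_two]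
  simp [Matrix.mul_apply, Fin.sum_univ_two]
  ring

/-- `(g T^w g⁻¹) (col0 g) = col0 g`. [folklore] -/
theorem conj_T_zpow_mulVec_col0 (g : SL(2, ℤ)) (w : ℤ) :
    ((g * ModularGroup.T ^ w * g⁻¹ : SL(2, ℤ)) : Matrix (Fin 2) (Fin 2) ℤ) *ᵥ col0 g = col0 g := by
  have h : (g * ModularGroup.T ^ w * g⁻¹ : SL(2, ℤ)) * g = g * ModularGroup.T ^ w := by group
  rw [← mulVec_e0, Matrix.mulVec_mulVec, ← Matrix.SpecialLinearGroup.coe_mul, h,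
    Matrix.SpecialLinearGroup.coe_mul, ← Matrix.mulVec_mulVec, T_zpow_mulVec_e0]

/-- **A parabolic element has an integral eigenvector**: if `Q` is parabolic then
`IsEigenElt Q (col0 g)` for the `g` of `Q = ± g T^w g⁻¹`. [cite: Shimura1971, §1.3–1.5] -/
theorem exists_isEigenElt_of_isParabolic {Q : Gamma0 N} (hQ : (gmat Q).IsParabolic) :
    ∃ v, IsEigenElt Q v := by
  obtain ⟨g, w, hgw⟩ := ParabolicConj.exists_conj_T_zpow_of_isParabolic hQ
  refine ⟨col0 g, col0_ne_zero g, ?_, fun h1 ↦ hQ.1 ⟨1, by simp [h1]⟩,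
    fun h1 ↦ hQ.1 ⟨-1, by simp [h1]⟩⟩
  rcases hgw with h | h
  · left
    change ((Q : SL(2, ℤ)) : Matrix (Fin 2) (Fin 2) ℤ) *ᵥ col0 g = col0 g
    rw [h]
    exact conj_T_zpow_mulVec_col0 g w
  · right
    change ((Q : SL(2, ℤ)) : Matrix (Fin 2) (Fin 2) ℤ) *ᵥ col0 g = -col0 g
    rw [h, Matrix.SpecialLinearGroup.coe_neg, Matrix.neg_mulVec, conj_T_zpow_mulVec_col0]

/-- An element with an eigenvector for `±1`, other than `±1`, is parabolic. [cite: Shimura1971, §1.3] -/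
theorem isParabolic_of_isEigenElt {Q : Gamma0 N} {v : Fin 2 → ℤ} (h : IsEigenElt Q v) :
    (gmat Q).IsParabolic := by
  obtain ⟨hv, hQv, h1, hm1⟩ := h
  -- an eigenvalue `ε = ±1`
  obtain ⟨ε, hε, hε2⟩ : ∃ ε : ℤ, gmat Q *ᵥ v = ε • v ∧ ε * ε = 1 := by
    rcases hQv with h | h
    · exact ⟨1, by rw [h, one_smul], by norm_num⟩
    · exact ⟨-1, by rw [h, neg_one_smul], by norm_num⟩
  set A := gmat Q with hA
  have hdet : A 0 0 * A 1 1 - A 0 1 * A 1 0 = 1 := by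
    rw [← Matrix.det_fin_two, hA]
    exact Matrix.SpecialLinearGroup.det_coe _
  have e0 : A 0 0 * v 0 + A 0 1 * v 1 = ε * v 0 := by
    have := congrFun hε 0
    simpa [Matrix.mulVec, dotProduct, Fin.sum_univ_two] using this
  have e1 : A 1 0 * v 0 + A 1 1 * v 1 = ε * v 1 := by
    have := congrFun hε 1
    simpa [Matrix.mulVec, dotProduct, Fin.sum_univ_two] using this
  -- `det (A - ε) = 2 - ε tr A` kills `v`, so `tr A = 2ε`
  have htr : A 0 0 + A 1 1 = 2 * ε := by
    have k0 : (2 - ε * (A 0 0 + A 1 1)) * v 0 = 0 := by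
      linear_combination (A 1 1 - ε) * e0 - A 0 1 * e1 - v 0 * hdet - v 0 * hε2
    have k1 : (2 - ε * (A 0 0 + A 1 1)) * v 1 = 0 := by
      linear_combination (A 0 0 - ε) * e1 - A 1 0 * e0 - v 1 * hdet - v 1 * hε2
    have hne : 2 - ε * (A 0 0 + A 1 1) = 0 := by
      by_contra hne
      apply hv
      funext k
      fin_cases k
      · exact (mul_eq_zero.mp k0).resolve_left hne
      · exact (mul_eq_zero.mp k1).resolve_left hne
    linear_combination (-ε) * hne - (A 0 0 + A 1 1) * hε2
  refine ⟨?_, ?_⟩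
  · rintro ⟨a, ha⟩
    have h00 : A 0 0 = a := by rw [← ha, Matrix.scalar_apply, Matrix.diagonal_apply_eq]
    have h11 : A 1 1 = a := by rw [← ha, Matrix.scalar_apply, Matrix.diagonal_apply_eq]
    have h01 : A 0 1 = 0 := by rw [← ha, Matrix.scalar_apply, Matrix.diagonal_apply_ne _ (by decide)]
    have h10 : A 1 0 = 0 := by rw [← ha, Matrix.scalar_apply, Matrix.diagonal_apply_ne _ (by decide)]
    rw [h00, h11, h01, h10] at hdet
    have ha1 : a = 1 ∨ a = -1 := Int.eq_one_or_neg_one_of_mul_eq_one (by linear_combination hdet)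
    rcases ha1 with rfl | rfl
    · exact h1 (by rw [← ha]; simp)
    · exact hm1 (by rw [← ha]; simp)
  · rw [Matrix.discr_fin_two, Matrix.trace_fin_two, hA, Matrix.SpecialLinearGroup.det_coe, ← hA, htr]
    linear_combination (4 : ℤ) * hε2

/-- **Structure of an element with an integral eigenvector**: `Q = ± g T^w g⁻¹` with `w ≠ 0`, and
the eigenvector is an integral multiple of `col0 g`. [cite: Shimura1971, §1.3–1.5] -/
theorem exists_conj_of_isEigenElt {Q : Gamma0 N} {v : Fin 2 → ℤ} (h : IsEigenElt Q v) :
    ∃ (g : SL(2, ℤ)) (w c : ℤ), w ≠ 0 ∧ c ≠ 0 ∧ v = c • col0 g ∧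
      ((Q : SL(2, ℤ)) = g * ModularGroup.T ^ w * g⁻¹ ∨
        (Q : SL(2, ℤ)) = -(g * ModularGroup.T ^ w * g⁻¹)) := by
  obtain ⟨g, w, hgw⟩ := ParabolicConj.exists_conj_T_zpow_of_isParabolic (isParabolic_of_isEigenElt h)
  obtain ⟨hv, hQv, h1, hm1⟩ := h
  have hw : w ≠ 0 := by
    rintro rfl
    rw [zpow_zero, mul_one, mul_inv_cancel] at hgw
    rcases hgw with h | h
    · exact h1 (by change ((Q : SL(2, ℤ)) : Matrix (Fin 2) (Fin 2) ℤ) = 1; rw [h]; rfl)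
    · exact hm1 (by
        change ((Q : SL(2, ℤ)) : Matrix (Fin 2) (Fin 2) ℤ) = -1
        rw [h, Matrix.SpecialLinearGroup.coe_neg]; rfl)
  -- `v' = g⁻¹ v` satisfies `T^w v' = ± v'`, hence `v'₁ = 0`
  set v' : Fin 2 → ℤ := ((g⁻¹ : SL(2, ℤ)) : Matrix (Fin 2) (Fin 2) ℤ) *ᵥ v with hv'
  have hgv' : (g : Matrix (Fin 2) (Fin 2) ℤ) *ᵥ v' = v := by
    rw [hv', Matrix.mulVec_mulVec, ← Matrix.SpecialLinearGroup.coe_mul, mul_inv_cancel,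
      Matrix.SpecialLinearGroup.coe_one, Matrix.one_mulVec]
  -- `P v = s v` for `P = g T^w g⁻¹` and a sign `s`
  obtain ⟨s, hs, hPv⟩ : ∃ s : ℤ, (s = 1 ∨ s = -1) ∧
      ((g * ModularGroup.T ^ w * g⁻¹ : SL(2, ℤ)) : Matrix (Fin 2) (Fin 2) ℤ) *ᵥ v = s • v := by
    have e : ∀ {X : SL(2, ℤ)}, (Q : SL(2, ℤ)) = -X → gmat Q = -(X : Matrix (Fin 2) (Fin 2) ℤ) := by
      intro X h
      change ((Q : SL(2, ℤ)) : Matrix (Fin 2) (Fin 2) ℤ) = _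
      rw [h, Matrix.SpecialLinearGroup.coe_neg]
    rcases hgw with h | h <;> rcases hQv with h' | h'
    · exact ⟨1, Or.inl rfl, by rw [one_smul]; change gmat Q *ᵥ v = v at h'; rwa [show gmat Q =
        ((g * ModularGroup.T ^ w * g⁻¹ : SL(2, ℤ)) : Matrix (Fin 2) (Fin 2) ℤ) from congrArg _ h] at h'⟩
    · exact ⟨-1, Or.inr rfl, by rw [neg_one_smul]; rwa [show gmat Q =
        ((g * ModularGroup.T ^ w * g⁻¹ : SL(2, ℤ)) : Matrix (Fin 2) (Fin 2) ℤ) from congrArg _ h] at h'⟩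
    · refine ⟨-1, Or.inr rfl, ?_⟩
      rw [e h, Matrix.neg_mulVec] at h'
      rw [neg_one_smul]
      exact neg_eq_iff_eq_neg.mp h'
    · refine ⟨1, Or.inl rfl, ?_⟩
      rw [e h, Matrix.neg_mulVec, neg_inj] at h'
      rw [one_smul]; exact h'
  have hTv' : ((ModularGroup.T ^ w : SL(2, ℤ)) : Matrix (Fin 2) (Fin 2) ℤ) *ᵥ v' = s • v' := by
    have h := congrArg (fun x ↦ ((g⁻¹ : SL(2, ℤ)) : Matrix (Fin 2) (Fin 2) ℤ) *ᵥ x) hPv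
    beta_reduce at h
    rw [Matrix.mulVec_smul, ← hv', Matrix.mulVec_mulVec, Matrix.SpecialLinearGroup.coe_mul,
      Matrix.SpecialLinearGroup.coe_mul, ← Matrix.mul_assoc, ← Matrix.mul_assoc,
      ← Matrix.SpecialLinearGroup.coe_mul g⁻¹ g, inv_mul_cancel, Matrix.SpecialLinearGroup.coe_one,
      Matrix.one_mul, ← Matrix.mulVec_mulVec, ← hv'] at h
    exact h
  have hv'1 : v' 1 = 0 := by
    have e0 := congrFun hTv' 0
    have e1 := congrFun hTv' 1
    rw [ModularGroup.coe_T_zpow] at e0 e1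
    simp only [Matrix.mulVec, dotProduct, Fin.sum_univ_two, Matrix.of_apply, Matrix.cons_val',
      Matrix.cons_val_zero, Matrix.cons_val_one, Matrix.empty_val', Matrix.cons_val_fin_one,
      Pi.smul_apply, smul_eq_mul, one_mul, zero_mul, zero_add] at e0 e1
    rcases hs with rfl | rfl
    · have : w * v' 1 = 0 := by linarith
      exact (mul_eq_zero.mp this).resolve_left hw
    · linarith
  refine ⟨g, w, v' 0, hw, ?_, ?_, hgw⟩
  · intro h0
    apply hv
    rw [← hgv']
    have : v' = 0 := by funext k; fin_cases k; exact h0; exact hv'1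
    rw [this, Matrix.mulVec_zero]
  · rw [← hgv']
    funext k
    fin_cases k <;> simp [col0, Matrix.mulVec, dotProduct, Fin.sum_univ_two, hv'1, mul_comm]

end Eigen

/-! ### Additive maps vanishing on parabolic elements -/

section Spaces

variable (N p : ℕ) (R : Type*) [CommRing R]

/-- **Additive maps `Γ₀(N) → R` vanishing on a prescribed set of elements** (as functions
`Γ₀(N) → Fin 1 → R`, the weight-`2` cocycles of the tree). [cite: Shimura1971, §8.1 (8.1.4)] -/
def homSp (P : Gamma0 N → Prop) : Submodule R (Gamma0 N → Fin 1 → R) where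
  carrier := {u | (∀ γ δ, u (γ * δ) = u δ + u γ) ∧ ∀ Q, P Q → u Q = 0}
  add_mem' := by
    rintro u v ⟨hu, hu'⟩ ⟨hv, hv'⟩
    refine ⟨fun γ δ ↦ ?_, fun Q hQ ↦ ?_⟩
    · simp only [Pi.add_apply, hu, hv]; abel
    · simp [hu' Q hQ, hv' Q hQ]
  zero_mem' := ⟨fun _ _ ↦ by simp, fun _ _ ↦ rfl⟩
  smul_mem' := by
    rintro c u ⟨hu, hu'⟩
    refine ⟨fun γ δ ↦ ?_, fun Q hQ ↦ ?_⟩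
    · simp only [Pi.smul_apply, hu, smul_add]
    · simp [hu' Q hQ]

/-- **`parSp N R`: additive maps vanishing on all parabolic elements** (the parabolic cocycles of
weight `2`). [cite: Shimura1971, §8.1 (8.1.4)] -/
def parSp : Submodule R (Gamma0 N → Fin 1 → R) := homSp N R fun Q ↦ ∃ v, IsEigenElt Q v

/-- **`infSp N p R`: additive maps vanishing on the parabolic elements at the cusps above `∞` of
`X₀(p)`** (eigenvector `(a, c)` with `p ∣ c`, `p ∤ a`). [cite: Hida2022EMI, §4.2.10] -/
def infSp : Submodule R (Gamma0 N → Fin 1 → R) :=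
  homSp N R fun Q ↦ ∃ v, IsEigenElt Q v ∧ (p : ℤ) ∣ v 1 ∧ ¬ (p : ℤ) ∣ v 0

variable {N p R}

/-- Unfolding `homSp`. [folklore] -/
theorem mem_homSp_iff {P : Gamma0 N → Prop} {u : Gamma0 N → Fin 1 → R} :
    u ∈ homSp N R P ↔ (∀ γ δ, u (γ * δ) = u δ + u γ) ∧ ∀ Q, P Q → u Q = 0 := Iff.rfl

/-- `parSp ≤ infSp`. [folklore] -/
theorem parSp_le_infSp : parSp N R ≤ infSp N p R := by
  rintro u ⟨hu, hu'⟩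
  exact ⟨hu, fun Q ⟨v, hv, _⟩ ↦ hu' Q ⟨v, hv⟩⟩

/-- `homSp ≤ cocycles 0 N R` (additive maps are the weight-`2` cocycles). [folklore] -/
theorem homSp_le_cocycles (P : Gamma0 N → Prop) : homSp N R P ≤ cocycles 0 N R := by
  rintro u ⟨hu, -⟩
  refine mem_cocycles_iff.mpr fun γ δ ↦ ?_
  rw [act_zero_eq_id, LinearMap.id_apply, hu]

/-- An additive map vanishes at `1`. [folklore] -/
theorem map_one_of_mem_homSp {P : Gamma0 N → Prop} {u : Gamma0 N → Fin 1 → R}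
    (hu : u ∈ homSp N R P) : u 1 = 0 := by
  have h := hu.1 1 1
  rw [mul_one] at h
  have : u 1 + u 1 = u 1 + 0 := by rw [add_zero]; exact h.symm
  exact add_left_cancel this

/-- An additive map on powers: `u (γ^k) = k • u γ`. [folklore] -/
theorem map_pow_of_mem_homSp {P : Gamma0 N → Prop} {u : Gamma0 N → Fin 1 → R}
    (hu : u ∈ homSp N R P) (γ : Gamma0 N) (k : ℕ) : u (γ ^ k) = k • u γ := by
  induction k with
  | zero => rw [pow_zero, map_one_of_mem_homSp hu, zero_smul]
  | succ k ih => rw [pow_succ, hu.1, ih, succ_nsmul']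

end Spaces

/-! ### The key computation: `U_p` kills the values at all parabolic elements -/

section KeyMat

variable {N p : ℕ}

/-- `g⁻¹ g = 1` on matrices. [folklore] -/
theorem coe_inv_mul_coe (g : SL(2, ℤ)) :
    ((g⁻¹ : SL(2, ℤ)) : Matrix (Fin 2) (Fin 2) ℤ) * (g : Matrix (Fin 2) (Fin 2) ℤ) = 1 := by
  rw [← Matrix.SpecialLinearGroup.coe_mul, inv_mul_cancel, Matrix.SpecialLinearGroup.coe_one]

/-- `g g⁻¹ = 1` on matrices. [folklore] -/
theorem coe_mul_coe_inv (g : SL(2, ℤ)) :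
    (g : Matrix (Fin 2) (Fin 2) ℤ) * ((g⁻¹ : SL(2, ℤ)) : Matrix (Fin 2) (Fin 2) ℤ) = 1 := by
  rw [← Matrix.SpecialLinearGroup.coe_mul, mul_inv_cancel, Matrix.SpecialLinearGroup.coe_one]

/-- Powers of `T` multiply on matrices. [folklore] -/
theorem coe_T_zpow_mul_coe_T_zpow (a b : ℤ) :
    ((ModularGroup.T ^ a : SL(2, ℤ)) : Matrix (Fin 2) (Fin 2) ℤ) *
        ((ModularGroup.T ^ b : SL(2, ℤ)) : Matrix (Fin 2) (Fin 2) ℤ) =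
      ((ModularGroup.T ^ (a + b) : SL(2, ℤ)) : Matrix (Fin 2) (Fin 2) ℤ) := by
  rw [← Matrix.SpecialLinearGroup.coe_mul, ← _root_.zpow_add]

/-- The matrix `g'` with `βⱼ g = g' diag(p, 1)` when `p ∣ a + jc`:
`g' = ((a + jc)/p, b + jd; c, pd)`. [folklore] -/
def liftMat (hp : p.Prime) (g : SL(2, ℤ)) (j : ℤ) (hdvd : (p : ℤ) ∣ g 0 0 + j * g 1 0) : SL(2, ℤ) :=
  ⟨!![(g 0 0 + j * g 1 0) / p, g 0 1 + j * g 1 1; g 1 0, p * g 1 1], by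
    obtain ⟨q, hq⟩ := hdvd
    have hp0 : (p : ℤ) ≠ 0 := by exact_mod_cast hp.ne_zero
    have hdiv : (g 0 0 + j * g 1 0) / p = q := by rw [hq, Int.mul_ediv_cancel_left _ hp0]
    have hdet := Matrix.det_fin_two (g : Matrix (Fin 2) (Fin 2) ℤ)
    rw [g.det_coe] at hdet
    rw [Matrix.det_fin_two_of, hdiv]
    linear_combination (-(g 1 1 : ℤ)) * hq - hdet⟩

/-- The entries of `liftMat`. [folklore] -/
theorem coe_liftMat (hp : p.Prime) (g : SL(2, ℤ)) (j : ℤ) (hdvd : (p : ℤ) ∣ g 0 0 + j * g 1 0) :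
    (liftMat hp g j hdvd : Matrix (Fin 2) (Fin 2) ℤ) =
      !![(g 0 0 + j * g 1 0) / p, g 0 1 + j * g 1 1; g 1 0, p * g 1 1] := rfl

/-- `βⱼ g = g' diag(p, 1)`. [folklore] -/
theorem heckeRep_mul_eq_liftMat_mul (hp : p.Prime) (g : SL(2, ℤ)) (j : ℤ)
    (hdvd : (p : ℤ) ∣ g 0 0 + j * g 1 0) :
    !![1, j; 0, (p : ℤ)] * (g : Matrix (Fin 2) (Fin 2) ℤ) =
      (liftMat hp g j hdvd : Matrix (Fin 2) (Fin 2) ℤ) * !![(p : ℤ), 0; 0, 1] := by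
  obtain ⟨q, hq⟩ := hdvd
  have hp0 : (p : ℤ) ≠ 0 := by exact_mod_cast hp.ne_zero
  have hdiv : (g 0 0 + j * g 1 0) / p = q := by rw [hq, Int.mul_ediv_cancel_left _ hp0]
  rw [coe_liftMat, hdiv]
  ext a b
  fin_cases a <;> fin_cases b <;> simp [Matrix.mul_apply, Fin.sum_univ_two]
  · linear_combination hq
  · ring

/-- `diag(p, 1) T^k = T^{pk} diag(p, 1)`. [folklore] -/
theorem diag_mul_T_zpow (k : ℤ) :
    !![(p : ℤ), 0; 0, 1] * ((ModularGroup.T ^ k : SL(2, ℤ)) : Matrix (Fin 2) (Fin 2) ℤ) =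
      ((ModularGroup.T ^ ((p : ℤ) * k) : SL(2, ℤ)) : Matrix (Fin 2) (Fin 2) ℤ) * !![(p : ℤ), 0; 0, 1] := by
  rw [ModularGroup.coe_T_zpow, ModularGroup.coe_T_zpow]
  ext a b
  fin_cases a <;> fin_cases b <;> simp [Matrix.mul_apply, Fin.sum_univ_two, mul_comm]

/-- `π = ε g T^w g⁻¹` gives `πᵐ g = εᵐ g T^{wm}`. [folklore] -/
theorem pow_mul_eq_of_conj {π : Gamma0 N} {g : SL(2, ℤ)} {w : ℤ} {ε : ℤ}
    (hπ : gmat π = ε • ((g * ModularGroup.T ^ w * g⁻¹ : SL(2, ℤ)) : Matrix (Fin 2) (Fin 2) ℤ))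
    (m : ℕ) :
    gmat π ^ m * (g : Matrix (Fin 2) (Fin 2) ℤ) =
      ε ^ m • ((g : Matrix (Fin 2) (Fin 2) ℤ) *
        ((ModularGroup.T ^ (w * m) : SL(2, ℤ)) : Matrix (Fin 2) (Fin 2) ℤ)) := by
  have hπg : gmat π * (g : Matrix (Fin 2) (Fin 2) ℤ) =
      ε • ((g : Matrix (Fin 2) (Fin 2) ℤ) * ((ModularGroup.T ^ w : SL(2, ℤ)) : Matrix (Fin 2) (Fin 2) ℤ)) := by
    rw [hπ, Matrix.smul_mul, Matrix.SpecialLinearGroup.coe_mul, Matrix.SpecialLinearGroup.coe_mul,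
      Matrix.mul_assoc, coe_inv_mul_coe, Matrix.mul_one]
  induction m with
  | zero => simp
  | succ m ih =>
    rw [pow_succ, Matrix.mul_assoc, hπg, Matrix.mul_smul, ← Matrix.mul_assoc, ih, Matrix.smul_mul,
      smul_smul, ← pow_succ', Matrix.mul_assoc, coe_T_zpow_mul_coe_T_zpow]
    congr 3
    push_cast
    ring

end KeyMat

section Key

variable {N p : ℕ} (hp : p.Prime) {R : Type*} [CommRing R]
include hp

/-- **The key computation.** Let `u ∈ infSp N p R` with `p = 0` in `R`, `p` odd, and let
`π ∈ Γ₀(N)` have an integral eigenvector.  If `Q ∈ Γ₀(N)` satisfies `Q βⱼ = βⱼ πᵐ` (`m ≥ 1`,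
`βⱼ = (1 j; 0 p)`), then `u(Q) = 0`: either `Q` is parabolic above `∞`, or `Q = z^p` with
`z ∈ Γ₀(N)`. [cite: Hida1986ENS, §4 Prop. 4.7] -/
theorem apply_eq_zero_of_mul_heckeRep_eq (hpR : (p : R) = 0) (hp2 : p ≠ 2)
    {u : Gamma0 N → Fin 1 → R} (hu : u ∈ infSp N p R) {π : Gamma0 N} {v : Fin 2 → ℤ}
    (hπ : IsEigenElt π v) (j : ZMod p) {m : ℕ} (hm : 0 < m) {Q : Gamma0 N}
    (hQ : gmat Q * heckeRep p (some j) = heckeRep p (some j) * gmat π ^ m) : u Q = 0 := by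
  obtain ⟨g, w, c, hw, -, -, hform⟩ := exists_conj_of_isEigenElt hπ
  -- `π = ε g T^w g⁻¹`
  obtain ⟨ε, hε, hπε⟩ : ∃ ε : ℤ, (ε = 1 ∨ ε = -1) ∧
      gmat π = ε • ((g * ModularGroup.T ^ w * g⁻¹ : SL(2, ℤ)) : Matrix (Fin 2) (Fin 2) ℤ) := by
    rcases hform with h | h
    · exact ⟨1, Or.inl rfl, by rw [one_smul]; exact congrArg _ h⟩
    · refine ⟨-1, Or.inr rfl, ?_⟩
      rw [neg_one_smul]
      change ((π : SL(2, ℤ)) : Matrix (Fin 2) (Fin 2) ℤ) = _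
      rw [h, Matrix.SpecialLinearGroup.coe_neg]
  have hεm : ε ^ m = 1 ∨ ε ^ m = -1 := by
    rcases hε with rfl | rfl
    · exact Or.inl (one_pow m)
    · exact neg_one_pow_eq_or ℤ m
  have hp0 : (p : ℤ) ≠ 0 := by exact_mod_cast hp.ne_zero
  have hβ : heckeRep p (some j) = !![1, (j.val : ℤ); 0, (p : ℤ)] := rfl
  have hdetβ : (heckeRep p (some j)).det ≠ 0 := det_heckeRep_ne_zero hp.ne_zero _
  have hπm := pow_mul_eq_of_conj hπε m
  have hwm : w * m ≠ 0 := mul_ne_zero hw (by exact_mod_cast hm.ne')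
  -- `πᵐ ≠ ±1` (comparing the entry `(0,1)` of `T^{wm} = ±1`)
  have hπm_ne : ∀ s : ℤ, (s = 1 ∨ s = -1) → gmat π ^ m ≠ s • (1 : Matrix (Fin 2) (Fin 2) ℤ) := by
    intro s hs h1
    apply hwm
    have h4 := hπm
    rw [h1, Matrix.smul_mul, Matrix.one_mul] at h4
    -- `s g = εᵐ g T^{wm}`; multiply by `g⁻¹` on the left
    have h5 := congrArg (fun X ↦ ((g⁻¹ : SL(2, ℤ)) : Matrix (Fin 2) (Fin 2) ℤ) * X) h4
    simp only [Matrix.mul_smul] at h5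
    rw [← Matrix.mul_assoc, coe_inv_mul_coe, Matrix.one_mul] at h5
    have h6 := congrFun (congrFun h5 0) 1
    rw [ModularGroup.coe_T_zpow, Matrix.smul_apply, Matrix.smul_apply, Matrix.one_apply_ne (by decide)]
      at h6
    simp only [smul_eq_mul, mul_zero, Matrix.of_apply, Matrix.cons_val', Matrix.cons_val_zero,
      Matrix.cons_val_one, Matrix.empty_val', Matrix.cons_val_fin_one] at h6
    rcases hεm with h | h
    · rw [h, one_mul] at h6; exact h6.symm
    · rw [h, neg_one_mul, zero_eq_neg] at h6; exact h6
  by_cases hdvd : (p : ℤ) ∣ g 0 0 + (j.val : ℤ) * g 1 0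
  · -- ### Case `p ∣ a + jc`: `Q = z^p`
    set g' := liftMat hp g j.val hdvd with hg'
    have hβg : heckeRep p (some j) * (g : Matrix (Fin 2) (Fin 2) ℤ) =
        (g' : Matrix (Fin 2) (Fin 2) ℤ) * !![(p : ℤ), 0; 0, 1] := by
      rw [hβ]; exact heckeRep_mul_eq_liftMat_mul hp g j.val hdvd
    -- `Q g' diag(p,1) = εᵐ g' T^{pwm} diag(p,1)`
    have key : gmat Q * (g' : Matrix (Fin 2) (Fin 2) ℤ) * !![(p : ℤ), 0; 0, 1] =
        (ε ^ m • ((g' : Matrix (Fin 2) (Fin 2) ℤ) *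
          ((ModularGroup.T ^ ((p : ℤ) * (w * m)) : SL(2, ℤ)) : Matrix (Fin 2) (Fin 2) ℤ))) *
          !![(p : ℤ), 0; 0, 1] := by
      rw [Matrix.mul_assoc, ← hβg, ← Matrix.mul_assoc, hQ, Matrix.mul_assoc, hπm, Matrix.mul_smul,
        ← Matrix.mul_assoc, hβg, Matrix.smul_mul, Matrix.mul_assoc, diag_mul_T_zpow,
        ← Matrix.mul_assoc]
    have hD : (!![(p : ℤ), 0; 0, 1] : Matrix (Fin 2) (Fin 2) ℤ).det ≠ 0 := by
      rw [Matrix.det_fin_two_of]; simpa using hp0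
    have key' := matrix_mul_right_cancel_of_det_ne_zero hD key
    -- the element `z = ± g' T^{wm} g'⁻¹` of `Γ₀(N)`
    set z₀ : SL(2, ℤ) := g' * ModularGroup.T ^ (w * m) * g'⁻¹ with hz₀
    have hz₀N : z₀ ∈ Gamma0 N := by
      rw [Gamma0_mem]
      have h10 : z₀ 1 0 = -(w * m) * g' 1 0 ^ 2 := conj_T_zpow_apply_10 g' (w * m)
      have hg'10 : g' 1 0 = g 1 0 := by
        rw [hg']; rfl
      have hπ10 : ((gmat π 1 0 : ℤ) : ZMod N) = 0 := by
        have := π.2; rw [Gamma0_mem] at this; exact this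
      have hπ10' : gmat π 1 0 = ε * (-w * g 1 0 ^ 2) := by
        rw [hπε, Matrix.smul_apply, smul_eq_mul]
        congr 1
        exact conj_T_zpow_apply_10 g w
      rw [h10, hg'10]
      rw [hπ10'] at hπ10
      push_cast at hπ10 ⊢
      have hεu : ((ε : ZMod N)) * (ε : ZMod N) = 1 := by
        rcases hε with rfl | rfl <;> simp
      linear_combination ((m : ZMod N) * (ε : ZMod N)) * hπ10 +
        ((w : ZMod N) * (m : ZMod N) * ((g 1 0 : ℤ) : ZMod N) ^ 2) * hεu
    -- the sign
    obtain ⟨s, hs, hsm⟩ : ∃ s : SL(2, ℤ), (s = 1 ∨ s = -1) ∧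
        (s : Matrix (Fin 2) (Fin 2) ℤ) = ε ^ m • (1 : Matrix (Fin 2) (Fin 2) ℤ) := by
      rcases hεm with h | h
      · exact ⟨1, Or.inl rfl, by rw [h, one_smul]; rfl⟩
      · exact ⟨-1, Or.inr rfl, by rw [h, Matrix.SpecialLinearGroup.coe_neg, neg_one_smul]; rfl⟩
    have hsN : s * z₀ ∈ Gamma0 N := by
      rcases hs with rfl | rfl
      · rw [one_mul]; exact hz₀N
      · have hneg1 : (-1 : SL(2, ℤ)) ∈ Gamma0 N := by rw [Gamma0_mem]; simp
        exact (Gamma0 N).mul_mem hneg1 hz₀N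
    set z : Gamma0 N := ⟨s * z₀, hsN⟩ with hz
    -- `Q = z^p`
    have hsp : s ^ p = s := by
      rcases hs with rfl | rfl
      · exact one_pow p
      · exact Odd.neg_one_pow (hp.odd_of_ne_two hp2)
    have hcomm : Commute s z₀ := by
      rcases hs with rfl | rfl
      · exact Commute.one_left z₀
      · exact (Commute.one_left z₀).neg_left
    have hzp : z ^ p = Q := by
      apply Subtype.ext
      rw [hz, SubmonoidClass.mk_pow]
      change (s * z₀) ^ p = (Q : SL(2, ℤ))
      rw [hcomm.mul_pow, hsp, hz₀]
      have hpow : (g' * ModularGroup.T ^ (w * m) * g'⁻¹) ^ p =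
          g' * ModularGroup.T ^ ((p : ℤ) * (w * m)) * g'⁻¹ := by
        rw [conj_pow, ← zpow_natCast, ← _root_.zpow_mul, mul_comm]
      rw [hpow]
      apply Matrix.SpecialLinearGroup.ext
      intro a b
      -- compare the matrices through `key'`
      have hQ' : ((Q : SL(2, ℤ)) : Matrix (Fin 2) (Fin 2) ℤ) =
          (s : Matrix (Fin 2) (Fin 2) ℤ) * (((g' : Matrix (Fin 2) (Fin 2) ℤ) *
            ((ModularGroup.T ^ ((p : ℤ) * (w * m)) : SL(2, ℤ)) : Matrix (Fin 2) (Fin 2) ℤ)) *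
              ((g'⁻¹ : SL(2, ℤ)) : Matrix (Fin 2) (Fin 2) ℤ)) := by
        rw [hsm, Matrix.smul_mul, Matrix.one_mul, ← Matrix.smul_mul, ← key']
        change gmat Q = gmat Q * (g' : Matrix (Fin 2) (Fin 2) ℤ) * ((g'⁻¹ : SL(2, ℤ)) : Matrix (Fin 2) (Fin 2) ℤ)
        rw [Matrix.mul_assoc, coe_mul_coe_inv, Matrix.mul_one]
      have := congrFun (congrFun hQ' a) b
      rw [Matrix.SpecialLinearGroup.coe_mul, Matrix.SpecialLinearGroup.coe_mul,
        Matrix.SpecialLinearGroup.coe_mul]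
      exact this.symm
    rw [← hzp, map_pow_of_mem_homSp hu z p]
    funext k
    rw [Pi.smul_apply, Pi.zero_apply, nsmul_eq_mul, hpR, zero_mul]
  · -- ### Case `p ∤ a + jc`: `Q` is parabolic above `∞`
    set w₀ : Fin 2 → ℤ := heckeRep p (some j) *ᵥ col0 g with hw₀
    have hw₀eq : w₀ = ![g 0 0 + (j.val : ℤ) * g 1 0, (p : ℤ) * g 1 0] := by
      rw [hw₀, hβ]
      funext k
      fin_cases k <;>
        simp [col0, Matrix.mulVec, dotProduct, Fin.sum_univ_two]
    -- `πᵐ (col0 g) = εᵐ col0 g`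
    have hπmcol : gmat π ^ m *ᵥ col0 g = ε ^ m • col0 g := by
      have h := congrArg (fun X : Matrix (Fin 2) (Fin 2) ℤ ↦ X *ᵥ ![1, 0]) hπm
      beta_reduce at h
      rw [← Matrix.mulVec_mulVec, mulVec_e0, Matrix.smul_mulVec, ← Matrix.mulVec_mulVec,
        T_zpow_mulVec_e0, mulVec_e0] at h
      exact h
    have hQw₀ : gmat Q *ᵥ w₀ = ε ^ m • w₀ := by
      rw [hw₀, Matrix.mulVec_mulVec, hQ, ← Matrix.mulVec_mulVec, hπmcol, Matrix.mulVec_smul]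
    refine hu.2 Q ⟨w₀, ⟨?_, ?_, ?_, ?_⟩, ?_, ?_⟩
    · intro h0
      have h00 := congrFun h0 0
      rw [hw₀eq, Matrix.cons_val_zero, Pi.zero_apply] at h00
      exact hdvd ⟨0, by rw [mul_zero]; exact h00⟩
    · rcases hεm with h | h
      · left; rw [hQw₀, h, one_smul]
      · right; rw [hQw₀, h, neg_one_smul]
    · -- `Q ≠ 1`: else `πᵐ = 1`
      intro h1
      refine hπm_ne 1 (Or.inl rfl) ?_
      rw [one_smul]
      have h2 : heckeRep p (some j) * gmat π ^ m = heckeRep p (some j) * 1 := by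
        rw [Matrix.mul_one, ← hQ, h1, Matrix.one_mul]
      have h3 := congrArg (fun X ↦ (heckeRep p (some j)).adjugate * X) h2
      simp only [← Matrix.mul_assoc, Matrix.adjugate_mul, Matrix.smul_mul, Matrix.one_mul] at h3
      exact smul_right_injective _ hdetβ h3
    · -- `Q ≠ -1`: else `πᵐ = -1`
      intro h1
      refine hπm_ne (-1) (Or.inr rfl) ?_
      have h2 : heckeRep p (some j) * gmat π ^ m = heckeRep p (some j) * ((-1 : ℤ) • 1) := by
        rw [← hQ, h1, neg_one_smul, Matrix.mul_neg, Matrix.neg_mul, Matrix.mul_one, Matrix.one_mul]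
      have h3 := congrArg (fun X ↦ (heckeRep p (some j)).adjugate * X) h2
      simp only [← Matrix.mul_assoc, Matrix.adjugate_mul, Matrix.smul_mul, Matrix.one_mul] at h3
      exact smul_right_injective _ hdetβ h3
    · rw [hw₀eq]; exact ⟨g 1 0, rfl⟩
    · rw [hw₀eq]; exact hdvd

variable [NeZero p]

/-- **`U_p` kills the values of `u ∈ infSp` at every parabolic element** (`p ∣ N`, `p = 0` in
`R`, `p` odd): `(U_p u)(π) = 0`. [cite: Hida1986ENS, §4 Prop. 4.7] -/
theorem heckeU_apply_eq_zero_of_mem_infSp (hpR : (p : R) = 0) (hp2 : p ≠ 2) (hpN : p ∣ N)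
    {u : Gamma0 N → Fin 1 → R} (hu : u ∈ infSp N p R) {π : Gamma0 N} {v : Fin 2 → ℤ}
    (hπ : IsEigenElt π v) : heckeU 0 N R hp u π = 0 := by
  classical
  set σ := heckePermEquiv hp π with hσ
  letI : Fintype (orbitRel.Quotient (Subgroup.zpowers σ) (HeckeIdx N p)) := Fintype.ofFinite _
  rw [heckeU_apply]
  simp only [act_zero_eq_id, LinearMap.id_apply]
  rw [sum_eq_sum_orbits σ (fun i ↦ u (heckePermElt hp π i))]
  refine Finset.sum_eq_zero fun q _ ↦ ?_
  rw [← apply_cyc hp (fun γ ↦ u γ) hu.1 (map_one_of_mem_homSp hu) π q.out]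
  -- the orbit product is `β π^m β⁻¹`
  set m := minimalPeriod σ q.out with hm
  have hmpos : 0 < m := Nat.pos_of_ne_zero (NeZero.ne (minimalPeriod (σ • ·) q.out))
  have hper : (σ ^ m) q.out = q.out := by
    have := isPeriodicPt_minimalPeriod σ q.out
    rw [IsPeriodicPt, IsFixedPt, ← Equiv.Perm.coe_pow] at this
    exact this
  obtain ⟨j, hj⟩ := heckeRep_eq_of_dvd hp hpN q.out
  have hQ := gmat_cyc_mul hp π q.out m
  rw [hper, hj] at hQ
  exact apply_eq_zero_of_mul_heckeRep_eq hp hpR hp2 hu hπ j hmpos hQ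

/-- **`U_p (infSp) ⊆ parSp`.** [cite: Hida1986ENS, §4 Prop. 4.7] -/
theorem heckeU_mem_parSp_of_mem_infSp (hpR : (p : R) = 0) (hp2 : p ≠ 2) (hpN : p ∣ N)
    {u : Gamma0 N → Fin 1 → R} (hu : u ∈ infSp N p R) : heckeU 0 N R hp u ∈ parSp N R := by
  refine ⟨fun γ δ ↦ ?_, fun Q ⟨v, hv⟩ ↦ heckeU_apply_eq_zero_of_mem_infSp hp hpR hp2 hpN hu hv⟩
  have hcoc := heckeU_mem_cocycles hp (homSp_le_cocycles _ hu)
  have := (mem_cocycles_iff.mp hcoc) γ δ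
  rwa [act_zero_eq_id, LinearMap.id_apply] at this

/-- `U_p (infSp) ⊆ infSp`. [folklore] -/
theorem heckeU_mem_infSp_of_mem_infSp (hpR : (p : R) = 0) (hp2 : p ≠ 2) (hpN : p ∣ N)
    {u : Gamma0 N → Fin 1 → R} (hu : u ∈ infSp N p R) : heckeU 0 N R hp u ∈ infSp N p R :=
  parSp_le_infSp (heckeU_mem_parSp_of_mem_infSp hp hpR hp2 hpN hu)

/-- `U_p (parSp) ⊆ parSp`. [folklore] -/
theorem heckeU_mem_parSp_of_mem_parSp (hpR : (p : R) = 0) (hp2 : p ≠ 2) (hpN : p ∣ N)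
    {u : Gamma0 N → Fin 1 → R} (hu : u ∈ parSp N R) : heckeU 0 N R hp u ∈ parSp N R :=
  heckeU_mem_parSp_of_mem_infSp hp hpR hp2 hpN (parSp_le_infSp hu)

end Key

/-! ### Consequences for the non-nilpotent ranks -/

section Ranks

variable {n N p : ℕ} [NeZero p] (hp : p.Prime) {K : Type*} [Field K]

variable (n N K) in
/-- The `uⁿ`-coefficient of a function `Γ₀(N) → K^{n+1}` (Hida's contraction on all functions).
[cite: Hida2022EMI, §4.2.11 (4.40)] -/
def proj0 : (Gamma0 N → Fin (n + 1) → K) →ₗ[K] (Gamma0 N → Fin 1 → K) where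
  toFun u γ _ := u γ 0
  map_add' _ _ := rfl
  map_smul' _ _ := rfl

/-- Unfolding `proj0`. [folklore] -/
@[simp] theorem proj0_apply (u : Gamma0 N → Fin (n + 1) → K) (γ : Gamma0 N) (k : Fin 1) :
    proj0 n N K u γ k = u γ 0 := rfl

/-- **The contraction is `U_p`-equivariant on all functions** (`p ∣ N`, `p = 0` in `K`).
[cite: Hida2022EMI, §4.2.11] -/
theorem proj0_heckeU (hpK : (p : K) = 0) (hpN : p ∣ N) (u : Gamma0 N → Fin (n + 1) → K) :
    proj0 n N K (heckeU n N K hp u) = heckeU 0 N K hp (proj0 n N K u) := by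
  funext γ k
  rw [proj0_apply, heckeU_apply, heckeU_apply, Finset.sum_apply, Finset.sum_apply]
  refine Finset.sum_congr rfl fun i _ ↦ ?_
  rw [act_heckeRep_apply_zero hp hpK hpN (heckePerm hp γ i), act_zero_eq_id, LinearMap.id_apply,
    proj0_apply]

/-- `U_p` kills the functions with vanishing `uⁿ`-coefficients. [cite: Hida2022EMI, §4.2.11] -/
theorem heckeU_eq_zero_of_proj0_eq_zero (hpK : (p : K) = 0) (hpN : p ∣ N)
    {u : Gamma0 N → Fin (n + 1) → K} (hu : proj0 n N K u = 0) : heckeU n N K hp u = 0 := by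
  funext γ
  rw [heckeU_apply, Pi.zero_apply]
  refine Finset.sum_eq_zero fun i _ ↦ act_heckeRep_eq_zero hp hpK hpN (heckePerm hp γ i) ?_
  have := congrFun (congrFun hu (heckePermElt hp γ i)) 0
  rwa [proj0_apply] at this

/-- **Rank inequality across a `U_p`-equivariant map killing nothing non-nilpotent** (restatement
of `finrank_sub_finrank_maxGenEigenspace_zero_le` for stable subspaces and a map between the
ambient spaces). [folklore] -/
theorem finrank_sub_le_of_restrict {W W' : Type*} [AddCommGroup W] [Module K W] [AddCommGroup W']
    [Module K W'] (A : Module.End K W) (B : Module.End K W') (f : W →ₗ[K] W')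
    (hAB : ∀ x, f (A x) = B (f x)) (hker : ∀ x, f x = 0 → A x = 0)
    (V : Submodule K W) (V' : Submodule K W') [FiniteDimensional K V] [FiniteDimensional K V']
    (hV : ∀ x ∈ V, A x ∈ V) (hV' : ∀ x ∈ V', B x ∈ V') (hf : ∀ x ∈ V, f x ∈ V') :
    finrank K V - finrank K ↥(Module.End.maxGenEigenspace (A.restrict hV) 0) ≤
      finrank K V' - finrank K ↥(Module.End.maxGenEigenspace (B.restrict hV') 0) :=
  finrank_sub_finrank_maxGenEigenspace_zero_le (f.restrict hf) (A.restrict hV) (B.restrict hV')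
    (fun x ↦ Subtype.ext (hAB x)) (fun x hx ↦ Subtype.ext (hker x (congrArg Subtype.val hx)))

variable [NeZero N]

/-- The spaces `homSp` are finite-dimensional. [folklore] -/
instance finiteDimensional_homSp (P : Gamma0 N → Prop) : FiniteDimensional K (homSp N K P) :=
  Submodule.finiteDimensional_of_le (homSp_le_cocycles P)

/-- `parSp` is finite-dimensional. [folklore] -/
instance finiteDimensional_parSp : FiniteDimensional K (parSp N K) := finiteDimensional_homSp _

/-- `infSp` is finite-dimensional. [folklore] -/
instance finiteDimensional_infSp : FiniteDimensional K (infSp N p K) := finiteDimensional_homSp _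

/-- **`ρ(U_p | infSp) ≤ ρ(U_p | parSp)`** for the non-nilpotent ranks `ρ = dim - dim (gen.
`0`-eigenspace)`, since `U_p` maps `infSp` into `parSp`. [cite: Hida1986ENS, §4 Prop. 4.7] -/
theorem finrank_sub_le_parSp (hpK : (p : K) = 0) (hp2 : p ≠ 2) (hpN : p ∣ N) :
    finrank K (infSp N p K) - finrank K ↥(Module.End.maxGenEigenspace
        ((heckeU 0 N K hp).restrict fun _ hu ↦ heckeU_mem_infSp_of_mem_infSp hp hpK hp2 hpN hu) 0) ≤
      finrank K (parSp N K) - finrank K ↥(Module.End.maxGenEigenspace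
        ((heckeU 0 N K hp).restrict fun _ hu ↦ heckeU_mem_parSp_of_mem_parSp hp hpK hp2 hpN hu) 0) :=
  finrank_sub_le_of_restrict _ _ (heckeU 0 N K hp) (fun _ ↦ rfl) (fun _ h ↦ h) _ _ _ _
    fun _ hu ↦ heckeU_mem_parSp_of_mem_infSp hp hpK hp2 hpN hu

/-- **Hida's contraction followed by the boundary step**: for a `U_p`-stable subspace `V` of
functions `Γ₀(N) → Symⁿ(K²)` whose `uⁿ`-coefficients lie in `infSp`,
`ρ(U_p | V) ≤ ρ(U_p | parSp)`. [cite: Hida2022EMI, §4.2.11] -/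
theorem finrank_sub_le_parSp_of_proj0 (hpK : (p : K) = 0) (hp2 : p ≠ 2) (hpN : p ∣ N)
    (V : Submodule K (Gamma0 N → Fin (n + 1) → K)) [FiniteDimensional K V]
    (hV : ∀ x ∈ V, heckeU n N K hp x ∈ V) (hVinf : ∀ x ∈ V, proj0 n N K x ∈ infSp N p K) :
    finrank K V - finrank K ↥(Module.End.maxGenEigenspace ((heckeU n N K hp).restrict hV) 0) ≤
      finrank K (parSp N K) - finrank K ↥(Module.End.maxGenEigenspace
        ((heckeU 0 N K hp).restrict fun _ hu ↦ heckeU_mem_parSp_of_mem_parSp hp hpK hp2 hpN hu) 0) :=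
  (finrank_sub_le_of_restrict _ _ (proj0 n N K) (proj0_heckeU hp hpK hpN)
    (fun _ h ↦ heckeU_eq_zero_of_proj0_eq_zero hp hpK hpN h) V (infSp N p K) hV
    (fun _ hu ↦ heckeU_mem_infSp_of_mem_infSp hp hpK hp2 hpN hu) hVinf).trans
    (finrank_sub_le_parSp hp hpK hp2 hpN)

end Ranks

/-! ### The Mazur count: `dim parSp ≤ 2 dim S₂(Γ₀(N))` -/

section Mazur

variable {N : ℕ} {K : Type*} [Field K]

variable (N K) in
/-- Forgetting the dummy index: functions `Γ₀(N) → Fin 1 → K` to functions `Γ₀(N) → K`.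
[folklore] -/
def toHom : (Gamma0 N → Fin 1 → K) →ₗ[K] (Gamma0 N → K) where
  toFun u γ := u γ 0
  map_add' _ _ := rfl
  map_smul' _ _ := rfl

/-- `toHom` is injective. [folklore] -/
theorem toHom_injective : Function.Injective (toHom N K) := by
  intro u v h
  funext γ k
  have hk : k = 0 := Subsingleton.elim _ _
  subst hk
  exact congrFun h γ

/-- `toHom` maps `parSp` into the tree's parabolic cocycles `ParabolicCountK.parabolicHoms`.
[cite: Shimura1971, §8.1 (8.1.4)] -/
theorem toHom_mem_parabolicHoms {u : Gamma0 N → Fin 1 → K} (hu : u ∈ parSp N K) :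
    toHom N K u ∈ ParabolicCountK.parabolicHoms K N := by
  refine ⟨fun γ δ ↦ ?_, fun γ hγ ↦ ?_⟩
  · change u (γ * δ) 0 = u γ 0 + u δ 0
    rw [hu.1, Pi.add_apply, add_comm]
  · obtain ⟨v, hv⟩ := exists_isEigenElt_of_isParabolic hγ
    change u γ 0 = 0
    rw [hu.2 γ ⟨v, hv⟩, Pi.zero_apply]

/-- **`dim parSp ≤ 2 dim S₂(Γ₀(N))`** over a field with `2 ≠ 0`, `3 ≠ 0` (the tree's Mazur count).
[cite: Mazur1977, II.5–II.9] -/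
theorem finrank_parSp_le [NeZero N] (h2 : (2 : K) ≠ 0) (h3 : (3 : K) ≠ 0) :
    finrank K (parSp N K) ≤ 2 * finrank ℂ (CuspForm (Gamma0 N) 2) := by
  have hf : ∀ u ∈ parSp N K, toHom N K u ∈ ParabolicCountK.parabolicHoms K N :=
    fun u hu ↦ toHom_mem_parabolicHoms hu
  have hinj : Function.Injective ((toHom N K).restrict hf) := by
    intro u v h
    apply Subtype.ext
    exact toHom_injective (congrArg Subtype.val h)
  haveI : FiniteDimensional K (ParabolicCountK.parabolicHoms K N) :=
    Module.Finite.of_injective (ParabolicCountK.liftHom K N) ParabolicCountK.liftHom_injective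
  exact (LinearMap.finrank_le_finrank_of_injective hinj).trans
    (ParabolicCountK.finrank_parabolicHoms_le h2 h3)

end Mazur

end Literature.NumberTheory.EllipticCurves.ModularForms.HidaCohomology
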